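import Summits.BirchSwinnertonDyer.BirchSwinnertonDyer.Theorems.ThetaPartnerAtTwoSignedKatoUpToAtTwoFrameTower
import Summits.BirchSwinnertonDyer.BirchSwinnertonDyer.Theorems.ThetaPartnerAtTwoSignedKatoUpToAtTwoFrameCoherent
import Summits.BirchSwinnertonDyer.BirchSwinnertonDyer.Theorems.ThetaPartnerAtTwoSignedKatoUpToAtTwoKatoBKTransport
import HarnessLib

/-!
# K3 `SignedKatoDivisibilityUpToAtTwo`, line `colemanrat` — FRAME-PRINT: the Kato pairing fact is EQUIVALENT to its print-shaped form
# with ONE `2`-adic completion frame, ONE coherent tower of `2`-power embeddings and ONE family of Galois lifts (in the kernel)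

Cell `pub/bsd-wall`, width seat `bsd-wall-tp2-p2x-w3` g11, `--supports stmt-BirchSwinnertonDyer-20308` (helper; closes nothing).
Completes the kernel version of the lead's costed upgrade «F∃ → F∀» (`Cruxes/SignedKatoDivisibilityUpToAtTwo/G9-LEAD-AUDIT.md` §4,
Steps A–C) for `F := Kato2004.exists_eulerSystem_expStar_tatePairing_values_two` (p640688), on top of `…FrameChange.lean` (Step A),
`…FrameLifts.lean` (Step C), `…FrameTower.lean` (Step B) and `…FrameCoherent.lean` (two coherent towers differ by one `ψ ∈ G_{ℚ₂}`):
`expStarTatePairing_body_congr` (the body of `F` sees `(e, τ)` only through the (KZ) right-hand side),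
`expStarTatePairing_body_allLifts_of_oneLift`, `expStarTatePairing_body_allTowers_of_oneTower` (ONE coherent tower with ONE lift family
⟹ EVERY coherent tower with EVERY lift family), `exists_coherentTower_two`, and the HEADLINE `expStarTatePairing_two_iff_oneFrame_oneTower`:
`F` ⟺ «… THERE IS a continuous frame `(Φ, φ)`, a coherent tower `e` and lifts `τ` such that for every pinned complex frame …» — the
booked fact's universal quantification over ALL `2`-adic frame data is certified EQUIVALENT to print's single choice of embeddings
(Kato (5.7.1)). Theorems only; standard axioms. HONEST FRAMING: `F` stays a named, unproved fact; K3/K3P′ NOT settled; BSD is not proved by this.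
-/

noncomputable section
open scoped Classical NumberField TensorProduct
open Field IsDedekindDomain CongruenceSubgroup NumberField WeierstrassCurve Polynomial
open Literature.NumberTheory.GaloisRepresentations
open Literature.NumberTheory.EllipticCurves Literature.NumberTheory.EllipticCurves.ModularForms
open Literature.NumberTheory.EllipticCurves.Rank1Residual Literature.NumberTheory.EllipticCurves.Kobayashi2003
open Literature.NumberTheory.EllipticCurves.Kato2004 Literature.NumberTheory.EllipticCurves.Kato2004.EulerSystemValues
open ZpExtension

set_option linter.dupNamespace false
namespace Summit.BirchSwinnertonDyer.BirchSwinnertonDyer.Theorems.SignedKatoOffTwo.FrameChange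

/-! ## §1 The body of the fact sees `(e, τ)` only through the (KZ) right-hand side -/

section Body

variable (v : HeightOneSpectrum (𝓞 ℚ)) (W : WeierstrassCurve ℚ) [W.IsElliptic] (κ : ZpExtension ℚ 2) (hκ : κ.IsCyclotomic)
  (f : CuspForm (Gamma0 (W.conductorNorm ℤ)) 2)
  [ContinuousSMul ℤ_[2] (W.tateModule 2)] [Module.Free ℤ_[2] (W.tateModule 2)] [Module.Finite ℤ_[2] (W.tateModule 2)]

set_option backward.isDefEq.respectTransparency false in
/-- **Congruence of the body in the frame data `(e, τ)`**: if two pairs `(e₁, τ₁)`, `(e₂, τ₂)` give the SAME (KZ) right-hand side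
`Σ_b τ_{n+2}(b) • (log_W(z(Q₀)) · e_{n+2}(x))` at every layer point, the body of `F` at `(Φ, e₁, τ₁)` implies the body at `(Φ, e₂, τ₂)`,
with the same witnesses. [folklore] -/
theorem expStarTatePairing_body_congr (Φ : AlgebraicClosure ℚ_[2] ≃ₐ[ℚ] AlgebraicClosure (v.adicCompletion ℚ))
    (e₁ e₂ : ∀ k : ℕ, CyclotomicField (cycLevel 2 k ∅) ℚ →ₐ[ℚ] PadicAlgCl 2)
    (τ₁ τ₂ : ∀ m : ℕ, ZMod (2 ^ m) → Field.absoluteGaloisGroup ℚ_[2])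
    (hRHS : ∀ (n : ℕ) (Q₀ : localPoints W ℚ_[2]),
      WeierstrassCurve.Affine.Point.map (W' := W)
          (Φ : AlgebraicClosure ℚ_[2] →ₐ[ℚ] AlgebraicClosure (v.adicCompletion ℚ))
          (show (W.baseChange (AlgebraicClosure ℚ_[2])).toAffine.Point from Q₀) ∈
        localLayerPointsOfEmb κ (closureEmb (K := ℚ) (v.adicCompletion ℚ)) W n →
      ∀ xv : CyclotomicField (cycLevel 2 (n + 2) ∅) ℚ,
        ∑ b : (ZMod (2 ^ (n + 2)))ˣ, τ₁ (n + 2) (b : ZMod (2 ^ (n + 2))) •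
            ((∑' i : ℕ, algebraMap ℚ_[2] (PadicAlgCl 2) (PowerSeries.coeff i (W.map (algebraMap ℚ ℚ_[2])).formalLog) *
                (WeierstrassCurve.Affine.Point.zCoord (show (W.baseChange (AlgebraicClosure ℚ_[2])).toAffine.Point from Q₀)) ^ i) *
              e₁ (n + 2) xv) =
          ∑ b : (ZMod (2 ^ (n + 2)))ˣ, τ₂ (n + 2) (b : ZMod (2 ^ (n + 2))) •
            ((∑' i : ℕ, algebraMap ℚ_[2] (PadicAlgCl 2) (PowerSeries.coeff i (W.map (algebraMap ℚ ℚ_[2])).formalLog) *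
                (WeierstrassCurve.Affine.Point.zCoord (show (W.baseChange (AlgebraicClosure ℚ_[2])).toAffine.Point from Q₀)) ^ i) *
              e₂ (n + 2) xv))
    (ιC : (m : ℕ) → (CyclotomicField m ℚ →+* ℂ))
    (H : ∃ κK : ℝ, κK ≠ 0 ∧
      ∃ ΛK : ∀ (k : ℕ) (r : Finset (HeightOneSpectrum (𝓞 ℚ))),
          H1 (tateRep W 2) (cycSubgroup 2 k r) →ₗ[ℤ_[2]] ℚ_[2] ⊗[ℚ] CyclotomicField (cycLevel 2 k r) ℚ,
        ∀ (c d a : ℤ) (A : ℕ), 0 < A → Int.gcd c (6 * 2 * A) = 1 → Int.gcd d (6 * 2 * W.conductorNorm ℤ) = 1 →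
          ∃ (z : ∀ (k : ℕ) (r : (cyclotomicLevelsRat 2 (badPlaces c d A (W.conductorNorm ℤ))).Ideals),
                H1 (tateRep W 2) ((cyclotomicLevelsRat 2 (badPlaces c d A (W.conductorNorm ℤ))).level k r.1))
            (x : ∀ (k : ℕ) (r : (cyclotomicLevelsRat 2 (badPlaces c d A (W.conductorNorm ℤ))).Ideals),
                CyclotomicField (cycLevel 2 k r.1) ℚ),
            ZetaBody W 2 f ιC κK ΛK c d a A z x ∧
            ∀ (n : ℕ) (Q₀ : localPoints W ℚ_[2])
              (hQv : WeierstrassCurve.Affine.Point.map (W' := W)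
                  (Φ : AlgebraicClosure ℚ_[2] →ₐ[ℚ] AlgebraicClosure (v.adicCompletion ℚ))
                  (show (W.baseChange (AlgebraicClosure ℚ_[2])).toAffine.Point from Q₀) ∈
                localLayerPointsOfEmb κ (closureEmb (K := ℚ) (v.adicCompletion ℚ)) W n),
              (∀ (X Y : AlgebraicClosure ℚ_[2]) (hXY : (W.baseChange (AlgebraicClosure ℚ_[2])).toAffine.Nonsingular X Y),
                  (show (W.baseChange (AlgebraicClosure ℚ_[2])).toAffine.Point from Q₀) = .some X Y hXY → 1 < Valued.v X) →
              ∃ t : ℤ_[2],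
                (∀ k : ℕ, CyclotomicLayer.tatePairingPk W κ v n k
                    (levelToLayerTwo W hκ (∅ : Set (HeightOneSpectrum (𝓞 ℚ))) n
                      (z (n + 2) (cyclotomicLevelsRat 2 (badPlaces c d A (W.conductorNorm ℤ))).idealOne))
                    ⟨_, hQv⟩ = PadicInt.toZModPow k t) ∧
                algebraMap ℚ_[2] (PadicAlgCl 2) (t : ℚ_[2]) =
                  ∑ b : (ZMod (2 ^ (n + 2)))ˣ, τ₁ (n + 2) (b : ZMod (2 ^ (n + 2))) •
                    ((∑' i : ℕ, algebraMap ℚ_[2] (PadicAlgCl 2) (PowerSeries.coeff i (W.map (algebraMap ℚ ℚ_[2])).formalLog) *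
                        (WeierstrassCurve.Affine.Point.zCoord
                          (show (W.baseChange (AlgebraicClosure ℚ_[2])).toAffine.Point from Q₀)) ^ i) *
                      e₁ (n + 2) (x (n + 2) (cyclotomicLevelsRat 2 (badPlaces c d A (W.conductorNorm ℤ))).idealOne))) :
    ∃ κK : ℝ, κK ≠ 0 ∧
      ∃ ΛK : ∀ (k : ℕ) (r : Finset (HeightOneSpectrum (𝓞 ℚ))),
          H1 (tateRep W 2) (cycSubgroup 2 k r) →ₗ[ℤ_[2]] ℚ_[2] ⊗[ℚ] CyclotomicField (cycLevel 2 k r) ℚ,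
        ∀ (c d a : ℤ) (A : ℕ), 0 < A → Int.gcd c (6 * 2 * A) = 1 → Int.gcd d (6 * 2 * W.conductorNorm ℤ) = 1 →
          ∃ (z : ∀ (k : ℕ) (r : (cyclotomicLevelsRat 2 (badPlaces c d A (W.conductorNorm ℤ))).Ideals),
                H1 (tateRep W 2) ((cyclotomicLevelsRat 2 (badPlaces c d A (W.conductorNorm ℤ))).level k r.1))
            (x : ∀ (k : ℕ) (r : (cyclotomicLevelsRat 2 (badPlaces c d A (W.conductorNorm ℤ))).Ideals),
                CyclotomicField (cycLevel 2 k r.1) ℚ),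
            ZetaBody W 2 f ιC κK ΛK c d a A z x ∧
            ∀ (n : ℕ) (Q₀ : localPoints W ℚ_[2])
              (hQv : WeierstrassCurve.Affine.Point.map (W' := W)
                  (Φ : AlgebraicClosure ℚ_[2] →ₐ[ℚ] AlgebraicClosure (v.adicCompletion ℚ))
                  (show (W.baseChange (AlgebraicClosure ℚ_[2])).toAffine.Point from Q₀) ∈
                localLayerPointsOfEmb κ (closureEmb (K := ℚ) (v.adicCompletion ℚ)) W n),
              (∀ (X Y : AlgebraicClosure ℚ_[2]) (hXY : (W.baseChange (AlgebraicClosure ℚ_[2])).toAffine.Nonsingular X Y),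
                  (show (W.baseChange (AlgebraicClosure ℚ_[2])).toAffine.Point from Q₀) = .some X Y hXY → 1 < Valued.v X) →
              ∃ t : ℤ_[2],
                (∀ k : ℕ, CyclotomicLayer.tatePairingPk W κ v n k
                    (levelToLayerTwo W hκ (∅ : Set (HeightOneSpectrum (𝓞 ℚ))) n
                      (z (n + 2) (cyclotomicLevelsRat 2 (badPlaces c d A (W.conductorNorm ℤ))).idealOne))
                    ⟨_, hQv⟩ = PadicInt.toZModPow k t) ∧
                algebraMap ℚ_[2] (PadicAlgCl 2) (t : ℚ_[2]) =
                  ∑ b : (ZMod (2 ^ (n + 2)))ˣ, τ₂ (n + 2) (b : ZMod (2 ^ (n + 2))) •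
                    ((∑' i : ℕ, algebraMap ℚ_[2] (PadicAlgCl 2) (PowerSeries.coeff i (W.map (algebraMap ℚ ℚ_[2])).formalLog) *
                        (WeierstrassCurve.Affine.Point.zCoord
                          (show (W.baseChange (AlgebraicClosure ℚ_[2])).toAffine.Point from Q₀)) ^ i) *
                      e₂ (n + 2) (x (n + 2) (cyclotomicLevelsRat 2 (badPlaces c d A (W.conductorNorm ℤ))).idealOne)) := by
  obtain ⟨κK, hκK, ΛK, hmain⟩ := H
  refine ⟨κK, hκK, ΛK, fun c d a A hA hc hd => ?_⟩
  obtain ⟨z, x, hbody, hKZ⟩ := hmain c d a A hA hc hd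
  refine ⟨z, x, hbody, fun n Q₀ hQv hformal => ?_⟩
  obtain ⟨t, ht, htval⟩ := hKZ n Q₀ hQv hformal
  exact ⟨t, ht, htval.trans (hRHS n Q₀ hQv _)⟩

end Body

/-! ## §2 One lift family ⟹ all; one coherent tower ⟹ all -/

section Frames

variable (v : HeightOneSpectrum (𝓞 ℚ)) (W : WeierstrassCurve ℚ) [W.IsElliptic] (κ : ZpExtension ℚ 2) (hκ : κ.IsCyclotomic)
  (f : CuspForm (Gamma0 (W.conductorNorm ℤ)) 2)
  [ContinuousSMul ℤ_[2] (W.tateModule 2)] [Module.Free ℤ_[2] (W.tateModule 2)] [Module.Finite ℤ_[2] (W.tateModule 2)]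

set_option backward.isDefEq.respectTransparency false in
/-- **FRAME-C at body level (one lift family ⟹ all).** For a continuous frame `(Φ, φ)` and a tower `e`, the body of `F` at a lift
family `τ₀` implies the body at every lift family `τ` of `e` — same witnesses (`kz_rhs_lift_independent`). [folklore] -/
theorem expStarTatePairing_body_allLifts_of_oneLift
    (Φ : AlgebraicClosure ℚ_[2] ≃ₐ[ℚ] AlgebraicClosure (v.adicCompletion ℚ)) (φ : ℚ_[2] ≃+* v.adicCompletion ℚ)
    (hΦφ : ∀ y : ℚ_[2], Φ (algebraMap ℚ_[2] (AlgebraicClosure ℚ_[2]) y) =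
      algebraMap (v.adicCompletion ℚ) (AlgebraicClosure (v.adicCompletion ℚ)) (φ y))
    (e : ∀ k : ℕ, CyclotomicField (cycLevel 2 k ∅) ℚ →ₐ[ℚ] PadicAlgCl 2)
    (τ₀ τ : ∀ m : ℕ, ZMod (2 ^ m) → Field.absoluteGaloisGroup ℚ_[2])
    (hτ₀ : ∀ (k : ℕ) (a : ZMod (2 ^ k)), IsUnit a →
      τ₀ k a • e k (IsCyclotomicExtension.zeta (cycLevel 2 k ∅) ℚ (CyclotomicField (cycLevel 2 k ∅) ℚ)) =
        e k (IsCyclotomicExtension.zeta (cycLevel 2 k ∅) ℚ (CyclotomicField (cycLevel 2 k ∅) ℚ)) ^ a.val)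
    (hτ : ∀ (k : ℕ) (a : ZMod (2 ^ k)), IsUnit a →
      τ k a • e k (IsCyclotomicExtension.zeta (cycLevel 2 k ∅) ℚ (CyclotomicField (cycLevel 2 k ∅) ℚ)) =
        e k (IsCyclotomicExtension.zeta (cycLevel 2 k ∅) ℚ (CyclotomicField (cycLevel 2 k ∅) ℚ)) ^ a.val)
    (ιC : (m : ℕ) → (CyclotomicField m ℚ →+* ℂ))
    (H : ∃ κK : ℝ, κK ≠ 0 ∧
      ∃ ΛK : ∀ (k : ℕ) (r : Finset (HeightOneSpectrum (𝓞 ℚ))),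
          H1 (tateRep W 2) (cycSubgroup 2 k r) →ₗ[ℤ_[2]] ℚ_[2] ⊗[ℚ] CyclotomicField (cycLevel 2 k r) ℚ,
        ∀ (c d a : ℤ) (A : ℕ), 0 < A → Int.gcd c (6 * 2 * A) = 1 → Int.gcd d (6 * 2 * W.conductorNorm ℤ) = 1 →
          ∃ (z : ∀ (k : ℕ) (r : (cyclotomicLevelsRat 2 (badPlaces c d A (W.conductorNorm ℤ))).Ideals),
                H1 (tateRep W 2) ((cyclotomicLevelsRat 2 (badPlaces c d A (W.conductorNorm ℤ))).level k r.1))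
            (x : ∀ (k : ℕ) (r : (cyclotomicLevelsRat 2 (badPlaces c d A (W.conductorNorm ℤ))).Ideals),
                CyclotomicField (cycLevel 2 k r.1) ℚ),
            ZetaBody W 2 f ιC κK ΛK c d a A z x ∧
            ∀ (n : ℕ) (Q₀ : localPoints W ℚ_[2])
              (hQv : WeierstrassCurve.Affine.Point.map (W' := W)
                  (Φ : AlgebraicClosure ℚ_[2] →ₐ[ℚ] AlgebraicClosure (v.adicCompletion ℚ))
                  (show (W.baseChange (AlgebraicClosure ℚ_[2])).toAffine.Point from Q₀) ∈
                localLayerPointsOfEmb κ (closureEmb (K := ℚ) (v.adicCompletion ℚ)) W n),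
              (∀ (X Y : AlgebraicClosure ℚ_[2]) (hXY : (W.baseChange (AlgebraicClosure ℚ_[2])).toAffine.Nonsingular X Y),
                  (show (W.baseChange (AlgebraicClosure ℚ_[2])).toAffine.Point from Q₀) = .some X Y hXY → 1 < Valued.v X) →
              ∃ t : ℤ_[2],
                (∀ k : ℕ, CyclotomicLayer.tatePairingPk W κ v n k
                    (levelToLayerTwo W hκ (∅ : Set (HeightOneSpectrum (𝓞 ℚ))) n
                      (z (n + 2) (cyclotomicLevelsRat 2 (badPlaces c d A (W.conductorNorm ℤ))).idealOne))
                    ⟨_, hQv⟩ = PadicInt.toZModPow k t) ∧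
                algebraMap ℚ_[2] (PadicAlgCl 2) (t : ℚ_[2]) =
                  ∑ b : (ZMod (2 ^ (n + 2)))ˣ, τ₀ (n + 2) (b : ZMod (2 ^ (n + 2))) •
                    ((∑' i : ℕ, algebraMap ℚ_[2] (PadicAlgCl 2) (PowerSeries.coeff i (W.map (algebraMap ℚ ℚ_[2])).formalLog) *
                        (WeierstrassCurve.Affine.Point.zCoord
                          (show (W.baseChange (AlgebraicClosure ℚ_[2])).toAffine.Point from Q₀)) ^ i) *
                      e (n + 2) (x (n + 2) (cyclotomicLevelsRat 2 (badPlaces c d A (W.conductorNorm ℤ))).idealOne))) :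
    ∃ κK : ℝ, κK ≠ 0 ∧
      ∃ ΛK : ∀ (k : ℕ) (r : Finset (HeightOneSpectrum (𝓞 ℚ))),
          H1 (tateRep W 2) (cycSubgroup 2 k r) →ₗ[ℤ_[2]] ℚ_[2] ⊗[ℚ] CyclotomicField (cycLevel 2 k r) ℚ,
        ∀ (c d a : ℤ) (A : ℕ), 0 < A → Int.gcd c (6 * 2 * A) = 1 → Int.gcd d (6 * 2 * W.conductorNorm ℤ) = 1 →
          ∃ (z : ∀ (k : ℕ) (r : (cyclotomicLevelsRat 2 (badPlaces c d A (W.conductorNorm ℤ))).Ideals),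
                H1 (tateRep W 2) ((cyclotomicLevelsRat 2 (badPlaces c d A (W.conductorNorm ℤ))).level k r.1))
            (x : ∀ (k : ℕ) (r : (cyclotomicLevelsRat 2 (badPlaces c d A (W.conductorNorm ℤ))).Ideals),
                CyclotomicField (cycLevel 2 k r.1) ℚ),
            ZetaBody W 2 f ιC κK ΛK c d a A z x ∧
            ∀ (n : ℕ) (Q₀ : localPoints W ℚ_[2])
              (hQv : WeierstrassCurve.Affine.Point.map (W' := W)
                  (Φ : AlgebraicClosure ℚ_[2] →ₐ[ℚ] AlgebraicClosure (v.adicCompletion ℚ))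
                  (show (W.baseChange (AlgebraicClosure ℚ_[2])).toAffine.Point from Q₀) ∈
                localLayerPointsOfEmb κ (closureEmb (K := ℚ) (v.adicCompletion ℚ)) W n),
              (∀ (X Y : AlgebraicClosure ℚ_[2]) (hXY : (W.baseChange (AlgebraicClosure ℚ_[2])).toAffine.Nonsingular X Y),
                  (show (W.baseChange (AlgebraicClosure ℚ_[2])).toAffine.Point from Q₀) = .some X Y hXY → 1 < Valued.v X) →
              ∃ t : ℤ_[2],
                (∀ k : ℕ, CyclotomicLayer.tatePairingPk W κ v n k
                    (levelToLayerTwo W hκ (∅ : Set (HeightOneSpectrum (𝓞 ℚ))) n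
                      (z (n + 2) (cyclotomicLevelsRat 2 (badPlaces c d A (W.conductorNorm ℤ))).idealOne))
                    ⟨_, hQv⟩ = PadicInt.toZModPow k t) ∧
                algebraMap ℚ_[2] (PadicAlgCl 2) (t : ℚ_[2]) =
                  ∑ b : (ZMod (2 ^ (n + 2)))ˣ, τ (n + 2) (b : ZMod (2 ^ (n + 2))) •
                    ((∑' i : ℕ, algebraMap ℚ_[2] (PadicAlgCl 2) (PowerSeries.coeff i (W.map (algebraMap ℚ ℚ_[2])).formalLog) *
                        (WeierstrassCurve.Affine.Point.zCoord
                          (show (W.baseChange (AlgebraicClosure ℚ_[2])).toAffine.Point from Q₀)) ^ i) *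
                      e (n + 2) (x (n + 2) (cyclotomicLevelsRat 2 (badPlaces c d A (W.conductorNorm ℤ))).idealOne)) :=
  expStarTatePairing_body_congr v W κ hκ f Φ e e τ₀ τ
    (fun n Q₀ hQv xv => kz_rhs_lift_independent hκ Φ φ hΦφ (e (n + 2)) (τ₀ (n + 2)) (τ (n + 2))
      (hτ₀ (n + 2)) (hτ (n + 2)) Q₀ hQv xv _) ιC H

set_option backward.isDefEq.respectTransparency false in
/-- **FRAME-B+C at body level (one coherent tower ⟹ all).** For a continuous frame `(Φ, φ)`, `κ` cyclotomic, a COHERENT tower `e`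
with a lift family `τ`: the body of `F` at `(e, τ)` implies the body at EVERY coherent tower `e'` with EVERY lift family `τ'` —
`e' = ψ ∘ e` for one `ψ ∈ G_{ℚ₂}` (`exists_gal_of_coherent_towers`), the body moves to `(ψ ∘ e, ψ τ ψ⁻¹)` by conjugating the Euler
system (`expStarTatePairing_body_towerChange`), and `ψ τ ψ⁻¹ ↦ τ'` is a change of lifts (`kz_rhs_lift_independent`).
[cite: Kato2004Asterisque, Thm. 12.5 (1) (pp. 221–222), (5.7.1) (p. 157)] -/
theorem expStarTatePairing_body_allTowers_of_oneTower
    (Φ : AlgebraicClosure ℚ_[2] ≃ₐ[ℚ] AlgebraicClosure (v.adicCompletion ℚ)) (φ : ℚ_[2] ≃+* v.adicCompletion ℚ)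
    (hΦφ : ∀ y : ℚ_[2], Φ (algebraMap ℚ_[2] (AlgebraicClosure ℚ_[2]) y) =
      algebraMap (v.adicCompletion ℚ) (AlgebraicClosure (v.adicCompletion ℚ)) (φ y))
    (e : ∀ k : ℕ, CyclotomicField (cycLevel 2 k ∅) ℚ →ₐ[ℚ] PadicAlgCl 2)
    (τ : ∀ m : ℕ, ZMod (2 ^ m) → Field.absoluteGaloisGroup ℚ_[2])
    (hcoh : ∀ k : ℕ, e (k + 1) (IsCyclotomicExtension.zeta (cycLevel 2 (k + 1) ∅) ℚ (CyclotomicField (cycLevel 2 (k + 1) ∅) ℚ)) ^ 2 =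
      e k (IsCyclotomicExtension.zeta (cycLevel 2 k ∅) ℚ (CyclotomicField (cycLevel 2 k ∅) ℚ)))
    (hτ : ∀ (k : ℕ) (a : ZMod (2 ^ k)), IsUnit a →
      τ k a • e k (IsCyclotomicExtension.zeta (cycLevel 2 k ∅) ℚ (CyclotomicField (cycLevel 2 k ∅) ℚ)) =
        e k (IsCyclotomicExtension.zeta (cycLevel 2 k ∅) ℚ (CyclotomicField (cycLevel 2 k ∅) ℚ)) ^ a.val)
    (ιC : (m : ℕ) → (CyclotomicField m ℚ →+* ℂ))
    (H : ∃ κK : ℝ, κK ≠ 0 ∧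
      ∃ ΛK : ∀ (k : ℕ) (r : Finset (HeightOneSpectrum (𝓞 ℚ))),
          H1 (tateRep W 2) (cycSubgroup 2 k r) →ₗ[ℤ_[2]] ℚ_[2] ⊗[ℚ] CyclotomicField (cycLevel 2 k r) ℚ,
        ∀ (c d a : ℤ) (A : ℕ), 0 < A → Int.gcd c (6 * 2 * A) = 1 → Int.gcd d (6 * 2 * W.conductorNorm ℤ) = 1 →
          ∃ (z : ∀ (k : ℕ) (r : (cyclotomicLevelsRat 2 (badPlaces c d A (W.conductorNorm ℤ))).Ideals),
                H1 (tateRep W 2) ((cyclotomicLevelsRat 2 (badPlaces c d A (W.conductorNorm ℤ))).level k r.1))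
            (x : ∀ (k : ℕ) (r : (cyclotomicLevelsRat 2 (badPlaces c d A (W.conductorNorm ℤ))).Ideals),
                CyclotomicField (cycLevel 2 k r.1) ℚ),
            ZetaBody W 2 f ιC κK ΛK c d a A z x ∧
            ∀ (n : ℕ) (Q₀ : localPoints W ℚ_[2])
              (hQv : WeierstrassCurve.Affine.Point.map (W' := W)
                  (Φ : AlgebraicClosure ℚ_[2] →ₐ[ℚ] AlgebraicClosure (v.adicCompletion ℚ))
                  (show (W.baseChange (AlgebraicClosure ℚ_[2])).toAffine.Point from Q₀) ∈
                localLayerPointsOfEmb κ (closureEmb (K := ℚ) (v.adicCompletion ℚ)) W n),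
              (∀ (X Y : AlgebraicClosure ℚ_[2]) (hXY : (W.baseChange (AlgebraicClosure ℚ_[2])).toAffine.Nonsingular X Y),
                  (show (W.baseChange (AlgebraicClosure ℚ_[2])).toAffine.Point from Q₀) = .some X Y hXY → 1 < Valued.v X) →
              ∃ t : ℤ_[2],
                (∀ k : ℕ, CyclotomicLayer.tatePairingPk W κ v n k
                    (levelToLayerTwo W hκ (∅ : Set (HeightOneSpectrum (𝓞 ℚ))) n
                      (z (n + 2) (cyclotomicLevelsRat 2 (badPlaces c d A (W.conductorNorm ℤ))).idealOne))
                    ⟨_, hQv⟩ = PadicInt.toZModPow k t) ∧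
                algebraMap ℚ_[2] (PadicAlgCl 2) (t : ℚ_[2]) =
                  ∑ b : (ZMod (2 ^ (n + 2)))ˣ, τ (n + 2) (b : ZMod (2 ^ (n + 2))) •
                    ((∑' i : ℕ, algebraMap ℚ_[2] (PadicAlgCl 2) (PowerSeries.coeff i (W.map (algebraMap ℚ ℚ_[2])).formalLog) *
                        (WeierstrassCurve.Affine.Point.zCoord
                          (show (W.baseChange (AlgebraicClosure ℚ_[2])).toAffine.Point from Q₀)) ^ i) *
                      e (n + 2) (x (n + 2) (cyclotomicLevelsRat 2 (badPlaces c d A (W.conductorNorm ℤ))).idealOne)))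
    (e' : ∀ k : ℕ, CyclotomicField (cycLevel 2 k ∅) ℚ →ₐ[ℚ] PadicAlgCl 2)
    (τ' : ∀ m : ℕ, ZMod (2 ^ m) → Field.absoluteGaloisGroup ℚ_[2])
    (hcoh' : ∀ k : ℕ, e' (k + 1) (IsCyclotomicExtension.zeta (cycLevel 2 (k + 1) ∅) ℚ (CyclotomicField (cycLevel 2 (k + 1) ∅) ℚ)) ^ 2 =
      e' k (IsCyclotomicExtension.zeta (cycLevel 2 k ∅) ℚ (CyclotomicField (cycLevel 2 k ∅) ℚ)))
    (hτ' : ∀ (k : ℕ) (a : ZMod (2 ^ k)), IsUnit a →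
      τ' k a • e' k (IsCyclotomicExtension.zeta (cycLevel 2 k ∅) ℚ (CyclotomicField (cycLevel 2 k ∅) ℚ)) =
        e' k (IsCyclotomicExtension.zeta (cycLevel 2 k ∅) ℚ (CyclotomicField (cycLevel 2 k ∅) ℚ)) ^ a.val) :
    ∃ κK : ℝ, κK ≠ 0 ∧
      ∃ ΛK : ∀ (k : ℕ) (r : Finset (HeightOneSpectrum (𝓞 ℚ))),
          H1 (tateRep W 2) (cycSubgroup 2 k r) →ₗ[ℤ_[2]] ℚ_[2] ⊗[ℚ] CyclotomicField (cycLevel 2 k r) ℚ,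
        ∀ (c d a : ℤ) (A : ℕ), 0 < A → Int.gcd c (6 * 2 * A) = 1 → Int.gcd d (6 * 2 * W.conductorNorm ℤ) = 1 →
          ∃ (z : ∀ (k : ℕ) (r : (cyclotomicLevelsRat 2 (badPlaces c d A (W.conductorNorm ℤ))).Ideals),
                H1 (tateRep W 2) ((cyclotomicLevelsRat 2 (badPlaces c d A (W.conductorNorm ℤ))).level k r.1))
            (x : ∀ (k : ℕ) (r : (cyclotomicLevelsRat 2 (badPlaces c d A (W.conductorNorm ℤ))).Ideals),
                CyclotomicField (cycLevel 2 k r.1) ℚ),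
            ZetaBody W 2 f ιC κK ΛK c d a A z x ∧
            ∀ (n : ℕ) (Q₀ : localPoints W ℚ_[2])
              (hQv : WeierstrassCurve.Affine.Point.map (W' := W)
                  (Φ : AlgebraicClosure ℚ_[2] →ₐ[ℚ] AlgebraicClosure (v.adicCompletion ℚ))
                  (show (W.baseChange (AlgebraicClosure ℚ_[2])).toAffine.Point from Q₀) ∈
                localLayerPointsOfEmb κ (closureEmb (K := ℚ) (v.adicCompletion ℚ)) W n),
              (∀ (X Y : AlgebraicClosure ℚ_[2]) (hXY : (W.baseChange (AlgebraicClosure ℚ_[2])).toAffine.Nonsingular X Y),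
                  (show (W.baseChange (AlgebraicClosure ℚ_[2])).toAffine.Point from Q₀) = .some X Y hXY → 1 < Valued.v X) →
              ∃ t : ℤ_[2],
                (∀ k : ℕ, CyclotomicLayer.tatePairingPk W κ v n k
                    (levelToLayerTwo W hκ (∅ : Set (HeightOneSpectrum (𝓞 ℚ))) n
                      (z (n + 2) (cyclotomicLevelsRat 2 (badPlaces c d A (W.conductorNorm ℤ))).idealOne))
                    ⟨_, hQv⟩ = PadicInt.toZModPow k t) ∧
                algebraMap ℚ_[2] (PadicAlgCl 2) (t : ℚ_[2]) =
                  ∑ b : (ZMod (2 ^ (n + 2)))ˣ, τ' (n + 2) (b : ZMod (2 ^ (n + 2))) •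
                    ((∑' i : ℕ, algebraMap ℚ_[2] (PadicAlgCl 2) (PowerSeries.coeff i (W.map (algebraMap ℚ ℚ_[2])).formalLog) *
                        (WeierstrassCurve.Affine.Point.zCoord
                          (show (W.baseChange (AlgebraicClosure ℚ_[2])).toAffine.Point from Q₀)) ^ i) *
                      e' (n + 2) (x (n + 2) (cyclotomicLevelsRat 2 (badPlaces c d A (W.conductorNorm ℤ))).idealOne)) := by
  obtain ⟨ψ, hψ⟩ := exists_gal_of_coherent_towers e e' hcoh hcoh'
  let g : AlgebraicClosure ℚ_[2] →ₐ[ℚ] AlgebraicClosure ℚ_[2] :=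
    ((AlgEquiv.restrictScalars ℚ (Field.absoluteGaloisGroup.toAlgEquiv ℚ_[2] ψ) :
        AlgebraicClosure ℚ_[2] ≃ₐ[ℚ] AlgebraicClosure ℚ_[2]) : AlgebraicClosure ℚ_[2] →ₐ[ℚ] AlgebraicClosure ℚ_[2])
  have hg : ∀ x, g x = ψ • x := fun _ => rfl
  have he' : ∀ (k : ℕ) (y : CyclotomicField (cycLevel 2 k ∅) ℚ), (g.comp (e k)) y = e' k y :=
    gal_comp_eq_of_smul_zeta_eq e e' ψ g hg hψ
  -- the body at the conjugated tower `(ψ ∘ e, ψ τ ψ⁻¹)`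
  have H₁ := expStarTatePairing_body_towerChange v W κ hκ f Φ φ hΦφ ψ g hg e τ ιC H
  -- `ψ τ ψ⁻¹` is a lift family for `e' = ψ ∘ e`
  have hτ₁ : ∀ (k : ℕ) (a : ZMod (2 ^ k)), IsUnit a →
      (ψ * τ k a * ψ⁻¹) • e' k (IsCyclotomicExtension.zeta (cycLevel 2 k ∅) ℚ (CyclotomicField (cycLevel 2 k ∅) ℚ)) =
        e' k (IsCyclotomicExtension.zeta (cycLevel 2 k ∅) ℚ (CyclotomicField (cycLevel 2 k ∅) ℚ)) ^ a.val := by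
    intro k a ha
    rw [← hψ k, mul_smul, mul_smul, inv_smul_smul, hτ k a ha, smul_pow']
  refine expStarTatePairing_body_congr v W κ hκ f Φ (fun k => g.comp (e k)) e' (fun m b => ψ * τ m b * ψ⁻¹) τ'
    (fun n Q₀ hQv xv => ?_) ιC H₁
  rw [he' (n + 2) xv]
  exact kz_rhs_lift_independent hκ Φ φ hΦφ (e' (n + 2)) (fun b => ψ * τ (n + 2) b * ψ⁻¹) (τ' (n + 2))
    (hτ₁ (n + 2)) (hτ' (n + 2)) Q₀ hQv xv _

end Frames
/-! ## §3 A coherent tower with lifts exists; the print-shaped form of the fact -/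

set_option backward.isDefEq.respectTransparency false in
/-- **A coherent tower of `2`-power embeddings with Galois lifts exists**: `e_k(ζ) = zeta 2 k` (the tree's `PadicCyclotomicTower`,
`zeta 2 (k+1)² = zeta 2 k`) with the lifts of `KatoBK.exists_tau_two`. [cite: Washington1997, §7.2] -/
theorem exists_coherentTower_two :
    ∃ (e : ∀ k : ℕ, CyclotomicField (cycLevel 2 k ∅) ℚ →ₐ[ℚ] PadicAlgCl 2)
      (τ : ∀ m : ℕ, ZMod (2 ^ m) → Field.absoluteGaloisGroup ℚ_[2]),
      (∀ k : ℕ, e (k + 1) (IsCyclotomicExtension.zeta (cycLevel 2 (k + 1) ∅) ℚ (CyclotomicField (cycLevel 2 (k + 1) ∅) ℚ)) ^ 2 =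
      e k (IsCyclotomicExtension.zeta (cycLevel 2 k ∅) ℚ (CyclotomicField (cycLevel 2 k ∅) ℚ))) ∧
      (∀ (k : ℕ) (a : ZMod (2 ^ k)), IsUnit a →
      τ k a • e k (IsCyclotomicExtension.zeta (cycLevel 2 k ∅) ℚ (CyclotomicField (cycLevel 2 k ∅) ℚ)) =
        e k (IsCyclotomicExtension.zeta (cycLevel 2 k ∅) ℚ (CyclotomicField (cycLevel 2 k ∅) ℚ)) ^ a.val) := by
  obtain ⟨e, he⟩ := KatoBK.exists_algHom_cyclotomicField_zeta_eq
  obtain ⟨τ, hτ⟩ := KatoBK.exists_tau_two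
  refine ⟨e, τ, fun k => ?_, fun k a ha => ?_⟩
  · rw [he, he]
    exact Summit.BirchSwinnertonDyer.Rank1Residual.Additive.PadicCyclotomicTower.zeta_succ_pow 2 k
  · rw [he]
    exact hτ k a ha

set_option backward.isDefEq.respectTransparency false in
/-- **HEADLINE — the Kato pairing fact is EQUIVALENT to its PRINT-SHAPED form (one frame, one tower, one lift family).**
`Kato2004.exists_eulerSystem_expStar_tatePairing_values_two` quantifies over EVERY continuous `2`-adic completion frame `(Φ, φ)`,
EVERY coherent tower `e` and EVERY lift family `τ`; print (Kato (5.7.1), Thm. 12.5 (1)) fixes ONE embedding. The two are equivalent: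
`→` instantiates at data that exist (`exists_continuousFrame_two`, `exists_coherentTower_two`); `←` = Steps B+C
(`expStarTatePairing_body_allTowers_of_oneTower`) then Step A (`expStarTatePairing_body_allFrames_of_oneFrame`). Nothing is asserted
about the fact itself, which stays a named, unproved input of the line `colemanrat`. [cite: Kato2004Asterisque, Thm. 12.5 (1) (pp. 221–222), (5.7.1) (p. 157)] -/
theorem expStarTatePairing_two_iff_oneFrame_oneTower :
    Kato2004.exists_eulerSystem_expStar_tatePairing_values_two ↔
    ∀ (v : HeightOneSpectrum (𝓞 ℚ)), ((2 : ℕ) : 𝓞 ℚ) ∈ v.asIdeal →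
    ∀ (W : WeierstrassCurve ℚ) [W.IsElliptic] [W.IsGloballyMinimal], GoodSS W 2 →
      ∀ (κ : ZpExtension ℚ 2) (hκ : κ.IsCyclotomic),
        ∀ [NeZero (W.conductorNorm ℤ)] (f : CuspForm (Gamma0 (W.conductorNorm ℤ)) 2), IsNewformOf W f →
        ∀ [ContinuousSMul ℤ_[2] (W.tateModule 2)] [Module.Free ℤ_[2] (W.tateModule 2)]
          [Module.Finite ℤ_[2] (W.tateModule 2)],
        ∃ (Φ : AlgebraicClosure ℚ_[2] ≃ₐ[ℚ] AlgebraicClosure (v.adicCompletion ℚ)) (φ : ℚ_[2] ≃+* v.adicCompletion ℚ)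
          (e : ∀ k : ℕ, CyclotomicField (cycLevel 2 k ∅) ℚ →ₐ[ℚ] PadicAlgCl 2)
          (τ : ∀ m : ℕ, ZMod (2 ^ m) → Field.absoluteGaloisGroup ℚ_[2]),
          (∀ y : ℚ_[2], Φ (algebraMap ℚ_[2] (AlgebraicClosure ℚ_[2]) y) =
      algebraMap (v.adicCompletion ℚ) (AlgebraicClosure (v.adicCompletion ℚ)) (φ y)) ∧
          (∀ k : ℕ, e (k + 1) (IsCyclotomicExtension.zeta (cycLevel 2 (k + 1) ∅) ℚ (CyclotomicField (cycLevel 2 (k + 1) ∅) ℚ)) ^ 2 =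
      e k (IsCyclotomicExtension.zeta (cycLevel 2 k ∅) ℚ (CyclotomicField (cycLevel 2 k ∅) ℚ))) ∧
          (∀ (k : ℕ) (a : ZMod (2 ^ k)), IsUnit a →
      τ k a • e k (IsCyclotomicExtension.zeta (cycLevel 2 k ∅) ℚ (CyclotomicField (cycLevel 2 k ∅) ℚ)) =
        e k (IsCyclotomicExtension.zeta (cycLevel 2 k ∅) ℚ (CyclotomicField (cycLevel 2 k ∅) ℚ)) ^ a.val) ∧
        ∀ (ιC : (m : ℕ) → (CyclotomicField m ℚ →+* ℂ)),
        (∀ k : ℕ, ιC (cycLevel 2 k ∅) (IsCyclotomicExtension.zeta (cycLevel 2 k ∅) ℚ (CyclotomicField (cycLevel 2 k ∅) ℚ)) =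
        Complex.exp (2 * Real.pi * Complex.I / (cycLevel 2 k ∅ : ℕ))) →
        ∃ κK : ℝ, κK ≠ 0 ∧
      ∃ ΛK : ∀ (k : ℕ) (r : Finset (HeightOneSpectrum (𝓞 ℚ))),
          H1 (tateRep W 2) (cycSubgroup 2 k r) →ₗ[ℤ_[2]] ℚ_[2] ⊗[ℚ] CyclotomicField (cycLevel 2 k r) ℚ,
        ∀ (c d a : ℤ) (A : ℕ), 0 < A → Int.gcd c (6 * 2 * A) = 1 → Int.gcd d (6 * 2 * W.conductorNorm ℤ) = 1 →
          ∃ (z : ∀ (k : ℕ) (r : (cyclotomicLevelsRat 2 (badPlaces c d A (W.conductorNorm ℤ))).Ideals),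
                H1 (tateRep W 2) ((cyclotomicLevelsRat 2 (badPlaces c d A (W.conductorNorm ℤ))).level k r.1))
            (x : ∀ (k : ℕ) (r : (cyclotomicLevelsRat 2 (badPlaces c d A (W.conductorNorm ℤ))).Ideals),
                CyclotomicField (cycLevel 2 k r.1) ℚ),
            ZetaBody W 2 f ιC κK ΛK c d a A z x ∧
            ∀ (n : ℕ) (Q₀ : localPoints W ℚ_[2])
              (hQv : WeierstrassCurve.Affine.Point.map (W' := W)
                  (Φ : AlgebraicClosure ℚ_[2] →ₐ[ℚ] AlgebraicClosure (v.adicCompletion ℚ))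
                  (show (W.baseChange (AlgebraicClosure ℚ_[2])).toAffine.Point from Q₀) ∈
                localLayerPointsOfEmb κ (closureEmb (K := ℚ) (v.adicCompletion ℚ)) W n),
              (∀ (X Y : AlgebraicClosure ℚ_[2]) (hXY : (W.baseChange (AlgebraicClosure ℚ_[2])).toAffine.Nonsingular X Y),
                  (show (W.baseChange (AlgebraicClosure ℚ_[2])).toAffine.Point from Q₀) = .some X Y hXY → 1 < Valued.v X) →
              ∃ t : ℤ_[2],
                (∀ k : ℕ, CyclotomicLayer.tatePairingPk W κ v n k
                    (levelToLayerTwo W hκ (∅ : Set (HeightOneSpectrum (𝓞 ℚ))) n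
                      (z (n + 2) (cyclotomicLevelsRat 2 (badPlaces c d A (W.conductorNorm ℤ))).idealOne))
                    ⟨_, hQv⟩ = PadicInt.toZModPow k t) ∧
                algebraMap ℚ_[2] (PadicAlgCl 2) (t : ℚ_[2]) =
                  ∑ b : (ZMod (2 ^ (n + 2)))ˣ, τ (n + 2) (b : ZMod (2 ^ (n + 2))) •
                    ((∑' i : ℕ, algebraMap ℚ_[2] (PadicAlgCl 2) (PowerSeries.coeff i (W.map (algebraMap ℚ ℚ_[2])).formalLog) *
                        (WeierstrassCurve.Affine.Point.zCoord
                          (show (W.baseChange (AlgebraicClosure ℚ_[2])).toAffine.Point from Q₀)) ^ i) *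
                      e (n + 2) (x (n + 2) (cyclotomicLevelsRat 2 (badPlaces c d A (W.conductorNorm ℤ))).idealOne)) := by
  constructor
  · intro hF v hv W _ _ hss κ hκ _ f hf _ _ _
    obtain ⟨Φ, φ, hΦφ⟩ := exists_continuousFrame_two v hv
    obtain ⟨e, τ, hcoh, hτ⟩ := exists_coherentTower_two
    exact ⟨Φ, φ, e, τ, hΦφ, hcoh, hτ, fun ιC hιC => hF v hv W hss κ hκ f hf Φ φ hΦφ e τ hcoh hτ ιC hιC⟩
  · intro h1 v hv W _ _ hss κ hκ _ f hf _ _ _ Φ' φ' hΦφ' e' τ' hcoh' hτ' ιC hιC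
    obtain ⟨Φ, φ, e, τ, hΦφ, hcoh, hτ, H⟩ := h1 v hv W hss κ hκ f hf
    refine expStarTatePairing_body_allFrames_of_oneFrame v W κ hκ f Φ φ hΦφ
      (fun e'' τ'' hcoh'' hτ'' ιC'' hιC'' => ?_) Φ' φ' hΦφ' e' τ' hcoh' hτ' ιC hιC
    exact expStarTatePairing_body_allTowers_of_oneTower v W κ hκ f Φ φ hΦφ e τ hcoh hτ ιC'' (H ιC'' hιC'') e'' τ'' hcoh'' hτ''

end Summit.BirchSwinnertonDyer.BirchSwinnertonDyer.Theorems.SignedKatoOffTwo.FrameChange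
end
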